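import Literature.Geometry.Riemannian.MetricFlowFLimitReproductionAux
import Literature.Geometry.Riemannian.WassersteinW1Prokhorov
import HarnessLib

/-!
# The reproduction formula survives `𝔽`-limits (Bamler 2023, §5.4, Lemma 5.20, Claim 5.22)

R. Bamler, *Compactness theory of the space of super Ricci flows*, Invent. Math. 233 (2023), §5.4,
proof of Lemma 5.20 (arXiv v1: Lemma 121; completeness of `(𝔽_I^J, d_𝔽^J)`), Claim 5.22 (arXiv
v1: Claim 123, *"`(𝒳^∞, (μ^∞_t))` is a metric flow pair"*), the verification of the reproduction
formula, Definition 3.2 (7), for the limit: *"For Property (7) fix `t₁, t₂, t₃ ∈ I ∖ E^∞`,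
`t₁ < t₂ < t₃`, `x^∞ ∈ X^∞_{t₃}`. It suffices to show that for every bounded Lipschitz function
`f` … `∫_{X^∞_{t₁}} f dν^∞_{x^∞;t₁} = ∫_{X^∞_{t₂}} ∫_{X^∞_{t₁}} f dν^∞_{y;t₁} dν^∞_{x^∞;t₂}(y)`.
… we may extend `f` to a bounded Lipschitz function `f̂ : Z_{t₁} → ℝ`. Fix a sequence
`xⁱ ∈ 𝒳ⁱ_{t₃}` such that `φⁱ_{t₃}(xⁱ) → x^∞`. Then by Claim 5.21
`∫ f̂ ∘ φⁱ_{t₁} dνⁱ_{xⁱ;t₁} → ∫ f dν^∞_{x^∞;t₁}`. Similarly, the functions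
`hⁱ : 𝒳ⁱ_{t₂} → ℝ, y ↦ ∫ f̂ ∘ φⁱ_{t₁} dνⁱ_{y;t₁}` are uniformly Lipschitz and for any sequence
`yⁱ ∈ 𝒳ⁱ_{t₂}` with `φⁱ_{t₂}(yⁱ) → y^∞ ∈ X^∞_{t₂}` we have `hⁱ(yⁱ) → ∫ f dν^∞_{y^∞;t₁}`. It
follows, again using Claim 5.21, that `∫ f dν^∞_{x^∞;t₁} ⟵ ∫ f̂ ∘ φⁱ_{t₁} dνⁱ_{xⁱ;t₁}
= ∫ hⁱ dνⁱ_{xⁱ;t₂} ⟶ ∫∫ f dν^∞_{y;t₁} dν^∞_{x^∞;t₂}(y)`."*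

We prove this step in ABSTRACT form, all metric-flow data being passed explicitly
(`integral_kernel_limit_eq_integral_integral`): complete separable comparison spaces `Z₁, Z₂`
(the spaces `Z_{t₁}, Z_{t₂}` of the correspondence), approximating slices `X₁ n, X₂ n`
(`𝒳ⁿ_{t₁}, 𝒳ⁿ_{t₂}`) with isometric embeddings `φ₁ n, φ₂ n`, the probability kernels
`κ₂₁ n y = νⁿ_{y;t₁}`, `y ∈ 𝒳ⁿ_{t₂}` (`W₁`-`1`-Lipschitz in `y`: Bamler 2023, §3.2, Proposition
comparing conjugate heat flows, (c)), the measures `κ₃₁ n = νⁿ_{xⁿ;t₁}`, `κ₃₂ n = νⁿ_{xⁿ;t₂}`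
tied by the reproduction formula of `𝒳ⁿ` (`hrep`, for `[0, ∞]`-valued measurable integrands),
their `W₁`-limits `ν₃₁`, `ν₃₂` (Claim 5.21), the closed limit slice `S₂ = X^∞_{t₂} ⊆ Z₂`
carrying `ν₃₂`, whose points are limits of points of the `𝒳ⁿ_{t₂}`, and the limit kernels
`ν₂₁ y = ν^∞_{y;t₁}` characterised as in Claim 5.21: `W₁`-limits of `νⁿ_{yⁿ;t₁}` along EVERY
sequence `φ₂ n yⁿ → y ∈ S₂`. Conclusion, for a bounded Lipschitz `g : Z₁ → ℝ` (the `f̂` of the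
source): `∫ g dν₃₁ = ∫ (∫ g dν₂₁(y)) dν₃₂(y)`. The same statement, read with `κ₃₁ n = μⁿ_{t₁}`,
`κ₃₂ n = μⁿ_{t₂}`, is the step *"The proof that `(μ^∞_t)` is a conjugate heat flow on `𝒳^∞` is
almost the same"*.

How the last arrow of the printed proof is made rigorous: `h^∞(y) := ∫ g dν^∞_{y;t₁}` is
`K`-Lipschitz and bounded on `S₂` (limit of `|hⁿ(yⁿ) − hⁿ(y'ⁿ)| ≤ K d(yⁿ, y'ⁿ)` along
approximating sequences); let `ĥ` be a bounded `K`-Lipschitz extension of `h^∞|S₂` to `Z₂`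
(McShane, clamped to `[−C, C]`). The convergence `hⁿ(yⁿ) → h^∞(y)` along approximating
sequences upgrades, by a finite-net argument, to the UNIFORM estimate `|hⁿ − ĥ ∘ φ₂ n| ≤ ε` on
the `φ₂ n`-preimage of a thickening of any compact `K ⊆ S₂`, for `n` large
(`exists_eventually_forall_abs_sub_le_of_mem_thickening`, in the Aux file); inner regularity of
`ν₃₂` on the Polish space `Z₂` provides a compact `K ⊆ S₂` of almost full `ν₃₂`-measure, and the
portmanteau theorem (through `ProbabilityMeasure.tendsto_of_tendsto_wassersteinW1`) bounds the
`(φ₂ n)_* κ₃₂ n`-mass of the (closed) complement of the thickening for `n` large; hence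
`∫ hⁿ dκ₃₂ n − ∫ ĥ d(φ₂ n)_* κ₃₂ n → 0`, while `∫ ĥ d(φ₂ n)_* κ₃₂ n → ∫ ĥ dν₃₂ = ∫ h^∞ dν₃₂` and
`∫ hⁿ dκ₃₂ n = ∫ g ∘ φ₁ n dκ₃₁ n = ∫ g d(φ₁ n)_* κ₃₁ n → ∫ g dν₃₁` (integrals of bounded
Lipschitz functions converge under `W₁`-convergence — the easy half of Kantorovich–Rubinstein,
`abs_integral_sub_integral_le_mul_wassersteinW1` in the Aux file).

Everything is proved; no definitions, no named facts. Not here: the gradient property (6) of the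
limit (`MetricFlowFLimitGradient.lean`), the support statement of Claim 5.21, and the passage
from bounded Lipschitz test functions to the set form of Definition 3.2 (7).

## References

* R. H. Bamler, *Compactness theory of the space of super Ricci flows*, Invent. Math. 233 (2023),
  1121–1277 (arXiv:2008.09298), §5.4, Lemma 5.20, Claims 5.21–5.22 (arXiv v1: Lemma 121,
  Claims 122–123); §3.1, Definition 3.2 (7). [Bamler2023]
* C. Villani, *Topics in Optimal Transportation*, GSM 58 (AMS 2003), Thm. 1.14
  (Kantorovich–Rubinstein, easy inequality), §7.1. [Villani2003]
-/

noncomputable section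

open Set MeasureTheory Filter TopologicalSpace Function Metric
open scoped Topology ENNReal NNReal

namespace Literature.Geometry.Riemannian

open _root_.Literature.MeasureTheory.Integral (abs_integral_le_of_forall_abs_le)

universe u

/-! ### The reproduction formula in the limit -/

/-- **Bamler 2023, Claim 5.22 (arXiv v1 Claim 123), reproduction formula (Def. 3.2 (7)) of the
limit, integral form.** Abstract data (times `t₁ < t₂ < t₃`): complete separable comparison spaces
`Z₁, Z₂`; slices `X₁ n = 𝒳ⁿ_{t₁}`, `X₂ n = 𝒳ⁿ_{t₂}` with isometric embeddings `φ₁ n, φ₂ n`; the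
kernels `κ₂₁ n y = νⁿ_{y;t₁}` (`W₁`-`1`-Lipschitz in `y`); `κ₃₁ n = νⁿ_{xⁿ;t₁}`,
`κ₃₂ n = νⁿ_{xⁿ;t₂}` with the reproduction formula `hrep` of `𝒳ⁿ`; their `W₁`-limits `ν₃₁, ν₃₂`;
the closed limit slice `S₂ = X^∞_{t₂}` with `ν₃₂(S₂ᶜ) = 0`, every point of which is a limit of
points `φ₂ n (yₙ)`; the limit kernels `ν₂₁ y = ν^∞_{y;t₁}`, `W₁`-limits of `(φ₁ n)_* νⁿ_{yₙ;t₁}`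
along every sequence `φ₂ n (yₙ) → y ∈ S₂` (Claim 5.21). Then for every bounded Lipschitz
`g : Z₁ → ℝ`: `∫ g dν₃₁ = ∫ (∫ g dν₂₁(y)) dν₃₂(y)`, i.e.
*"`∫_{X^∞_{t₁}} f dν^∞_{x^∞;t₁} = ∫_{X^∞_{t₂}} ∫_{X^∞_{t₁}} f dν^∞_{y;t₁} dν^∞_{x^∞;t₂}(y)`"*.
[cite: Bamler2023, §5.4, Lemma 5.20, Claim 5.22 (arXiv v1 Claim 123)] -/
theorem integral_kernel_limit_eq_integral_integral
    {Z₁ Z₂ : Type u} [MetricSpace Z₁] [MeasurableSpace Z₁] [BorelSpace Z₁]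
    [SecondCountableTopology Z₁] [CompleteSpace Z₁]
    [MetricSpace Z₂] [MeasurableSpace Z₂] [BorelSpace Z₂] [SecondCountableTopology Z₂]
    [CompleteSpace Z₂]
    {X₁ X₂ : ℕ → Type u} [∀ n, MetricSpace (X₁ n)] [∀ n, MeasurableSpace (X₁ n)]
    [∀ n, BorelSpace (X₁ n)] [∀ n, SecondCountableTopology (X₁ n)]
    [∀ n, MetricSpace (X₂ n)] [∀ n, MeasurableSpace (X₂ n)] [∀ n, BorelSpace (X₂ n)]
    [∀ n, SecondCountableTopology (X₂ n)]
    (φ₁ : ∀ n, X₁ n → Z₁) (φ₂ : ∀ n, X₂ n → Z₂) (hφ₁ : ∀ n, Isometry (φ₁ n))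
    (hφ₂ : ∀ n, Isometry (φ₂ n))
    -- `ν^n_{·;t₁}` on `𝒳^n_{t₂}`: probability kernels, `W₁`-`1`-Lipschitz
    (κ₂₁ : ∀ n, X₂ n → Measure (X₁ n)) [∀ n y, IsProbabilityMeasure (κ₂₁ n y)]
    (hκlip : ∀ n (y y' : X₂ n), wassersteinW1 (κ₂₁ n y) (κ₂₁ n y') ≤ edist y y')
    -- the kernels based at the points `x^n ∈ 𝒳^n_{t₃}`:
    -- `ν^n_{x^n;t₁} = ∫ ν^n_{y;t₁} dν^n_{x^n;t₂}(y)`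
    (κ₃₁ : ∀ n, Measure (X₁ n)) (κ₃₂ : ∀ n, Measure (X₂ n)) [∀ n, IsProbabilityMeasure (κ₃₁ n)]
    [∀ n, IsProbabilityMeasure (κ₃₂ n)]
    (hrep : ∀ n (f : X₁ n → ℝ≥0∞), Measurable f →
      ∫⁻ z, f z ∂κ₃₁ n = ∫⁻ y, ∫⁻ z, f z ∂κ₂₁ n y ∂κ₃₂ n)
    -- their `W₁`-limits in `Z₁`, `Z₂`
    (ν₃₁ : Measure Z₁) (ν₃₂ : Measure Z₂) [IsProbabilityMeasure ν₃₁] [IsProbabilityMeasure ν₃₂]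
    (h₃₁ : Tendsto (fun n ↦ wassersteinW1 ((κ₃₁ n).map (φ₁ n)) ν₃₁) atTop (𝓝 0))
    (h₃₂ : Tendsto (fun n ↦ wassersteinW1 ((κ₃₂ n).map (φ₂ n)) ν₃₂) atTop (𝓝 0))
    -- the limit slice `X_{t₂} ⊆ Z₂` (closed, carrying `ν^∞_{x;t₂}`); its points are limits of
    -- points
    (S₂ : Set Z₂) (hS₂ : IsClosed S₂) (hsupp : ν₃₂ S₂ᶜ = 0)
    (happrox : ∀ y ∈ S₂, ∃ yn : ∀ n, X₂ n, Tendsto (fun n ↦ φ₂ n (yn n)) atTop (𝓝 y))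
    -- the limit kernels `ν^∞_{y;t₁}`, `y ∈ X_{t₂}`: `W₁`-limits along every converging sequence
    (ν₂₁ : Z₂ → Measure Z₁) (hν₂₁ : ∀ y ∈ S₂, IsProbabilityMeasure (ν₂₁ y))
    (hconv : ∀ y ∈ S₂, ∀ yn : ∀ n, X₂ n, Tendsto (fun n ↦ φ₂ n (yn n)) atTop (𝓝 y) →
      Tendsto (fun n ↦ wassersteinW1 ((κ₂₁ n (yn n)).map (φ₁ n)) (ν₂₁ y)) atTop (𝓝 0))
    -- test function
    (g : Z₁ → ℝ) {K : ℝ≥0} (hg : LipschitzWith K g) {C : ℝ} (hgC : ∀ z, |g z| ≤ C) :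
    ∫ z, g z ∂ν₃₁ = ∫ y, (∫ z, g z ∂ν₂₁ y) ∂ν₃₂ := by
  -- preliminaries
  have hC0 : 0 ≤ C := by
    obtain ⟨z⟩ : Nonempty Z₁ := ν₃₁.nonempty_of_neZero
    exact (abs_nonneg _).trans (hgC z)
  have hφ₁m : ∀ n, Measurable (φ₁ n) := fun n ↦ (hφ₁ n).continuous.measurable
  have hφ₂m : ∀ n, Measurable (φ₂ n) := fun n ↦ (hφ₂ n).continuous.measurable
  have hgm : Measurable g := hg.continuous.measurable
  haveI hP₁ : ∀ n, IsProbabilityMeasure ((κ₃₁ n).map (φ₁ n)) := fun n ↦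
    Measure.isProbabilityMeasure_map (hφ₁m n).aemeasurable
  haveI hP₂ : ∀ n, IsProbabilityMeasure ((κ₃₂ n).map (φ₂ n)) := fun n ↦
    Measure.isProbabilityMeasure_map (hφ₂m n).aemeasurable
  haveI hP₂₁ : ∀ n y, IsProbabilityMeasure ((κ₂₁ n y).map (φ₁ n)) := fun n y ↦
    Measure.isProbabilityMeasure_map (hφ₁m n).aemeasurable
  -- Step 1: the functions `hⁿ(y) := ∫ g ∘ φ₁ n dνⁿ_{y;t₁}` are `K`-Lipschitz and bounded by `C`
  set h : ∀ n, X₂ n → ℝ := fun n y ↦ ∫ z, g (φ₁ n z) ∂κ₂₁ n y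
  have hgφ : ∀ n, LipschitzWith K fun z ↦ g (φ₁ n z) := fun n ↦
    LipschitzWith.of_dist_le_mul fun z z' ↦ (hg.dist_le_mul _ _).trans_eq (by rw [(hφ₁ n).dist_eq])
  have hh_lip : ∀ n, LipschitzWith K (h n) := fun n ↦ LipschitzWith.of_dist_le_mul fun y y' ↦ by
    have hfin : wassersteinW1 (κ₂₁ n y) (κ₂₁ n y') ≠ ∞ :=
      ne_top_of_le_ne_top (edist_ne_top y y') (hκlip n y y')
    rw [Real.dist_eq]
    calc |h n y - h n y'| ≤ K * (wassersteinW1 (κ₂₁ n y) (κ₂₁ n y')).toReal :=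
          abs_integral_sub_integral_le_mul_wassersteinW1 _ _ (hgφ n) (fun z ↦ hgC _) hfin
      _ ≤ K * dist y y' := by
          gcongr
          exact ENNReal.toReal_le_of_le_ofReal dist_nonneg (edist_dist y y' ▸ hκlip n y y')
  have hh_bdd : ∀ n y, |h n y| ≤ C := fun n y ↦ abs_integral_le_of_forall_abs_le _ fun z ↦ hgC _
  -- Step 2: `h^∞(y) := ∫ g dν^∞_{y;t₁}`; `hⁿ(yₙ) → h^∞(y)` along approximating sequences
  -- (Claim 5.21)
  set hinf : Z₂ → ℝ := fun y ↦ ∫ z, g z ∂ν₂₁ y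
  have hptw : ∀ a ∈ S₂, ∀ yn : ∀ n, X₂ n, Tendsto (fun n ↦ φ₂ n (yn n)) atTop (𝓝 a) →
      Tendsto (fun n ↦ h n (yn n)) atTop (𝓝 (hinf a)) := by
    intro a ha yn hyn
    haveI := hν₂₁ a ha
    have hlim := tendsto_integral_of_tendsto_wassersteinW1_zero (hconv a ha yn hyn) hg hgC
    exact hlim.congr fun n ↦ integral_map (hφ₁m n).aemeasurable hgm.aestronglyMeasurable
  -- Step 3: `h^∞` is `K`-Lipschitz and bounded by `C` on `S₂`; extend it to `ĥ = H` on `Z₂`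
  have hinf_lip : LipschitzOnWith K hinf S₂ := by
    refine LipschitzOnWith.of_dist_le_mul fun a ha a' ha' ↦ ?_
    obtain ⟨yn, hyn⟩ := happrox a ha
    obtain ⟨yn', hyn'⟩ := happrox a' ha'
    refine le_of_tendsto_of_tendsto' ((hptw a ha yn hyn).dist (hptw a' ha' yn' hyn'))
      ((hyn.dist hyn').const_mul (K : ℝ)) fun n ↦ ?_
    rw [(hφ₂ n).dist_eq]
    exact (hh_lip n).dist_le_mul _ _
  have hinf_bdd : ∀ a ∈ S₂, |hinf a| ≤ C := fun a ha ↦ by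
    obtain ⟨yn, hyn⟩ := happrox a ha
    exact le_of_tendsto' (hptw a ha yn hyn).abs fun n ↦ hh_bdd n _
  obtain ⟨H, hH_lip, hH_bdd, hH_eq⟩ := exists_lipschitzWith_extension_abs_le hinf_lip hC0 hinf_bdd
  have hHm : Measurable H := hH_lip.continuous.measurable
  have hSH : ∀ a ∈ S₂, ∃ yn : ∀ n, X₂ n, Tendsto (fun n ↦ φ₂ n (yn n)) atTop (𝓝 a) ∧
      Tendsto (fun n ↦ h n (yn n)) atTop (𝓝 (H a)) := fun a ha ↦ by
    obtain ⟨yn, hyn⟩ := happrox a ha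
    refine ⟨yn, hyn, ?_⟩
    rw [← hH_eq ha]
    exact hptw a ha yn hyn
  -- Step 4: `∫ hⁿ dκ₃₂ n = ∫ g d(φ₁ n)_* κ₃₁ n → ∫ g dν₃₁` and
  -- `∫ ĥ ∘ φ₂ n dκ₃₂ n → ∫ ĥ dν₃₂ = ∫ h^∞ dν₃₂`
  have hlim₁ : Tendsto (fun n ↦ ∫ y, h n y ∂κ₃₂ n) atTop (𝓝 (∫ z, g z ∂ν₃₁)) := by
    refine (tendsto_integral_of_tendsto_wassersteinW1_zero h₃₁ hg hgC).congr fun n ↦ ?_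
    rw [integral_map (hφ₁m n).aemeasurable hgm.aestronglyMeasurable]
    exact integral_eq_integral_integral_of_forall_lintegral (hrep n) (hgm.comp (hφ₁m n))
      (fun z ↦ hgC _) (hh_lip n).continuous.measurable
  have hlim₂ : Tendsto (fun n ↦ ∫ y, H (φ₂ n y) ∂κ₃₂ n) atTop (𝓝 (∫ y, hinf y ∂ν₃₂)) := by
    have hae : ∫ y, H y ∂ν₃₂ = ∫ y, hinf y ∂ν₃₂ := by
      refine integral_congr_ae ?_
      have hS : ∀ᵐ y ∂ν₃₂, y ∈ S₂ := mem_ae_iff.2 hsupp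
      filter_upwards [hS] with y hy using (hH_eq hy).symm
    rw [← hae]
    exact (tendsto_integral_of_tendsto_wassersteinW1_zero h₃₂ hH_lip hH_bdd).congr fun n ↦
      integral_map (hφ₂m n).aemeasurable hHm.aestronglyMeasurable
  -- Step 5: `|∫ hⁿ dκ₃₂ n − ∫ ĥ ∘ φ₂ n dκ₃₂ n| ≤ (2C + 1) ε` for `n` large
  have hkey : ∀ ε, 0 < ε →
      ∀ᶠ n in atTop, |∫ y, h n y ∂κ₃₂ n - ∫ y, H (φ₂ n y) ∂κ₃₂ n| ≤ (2 * C + 1) * ε := by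
    intro ε hε
    -- a compact `Kc ⊆ S₂` of almost full `ν₃₂`-measure (inner regularity on the Polish `Z₂`)
    obtain ⟨Kc, hKcS, hKc, hKcμ⟩ := hS₂.measurableSet.exists_isCompact_sdiff_lt
      (measure_ne_top ν₃₂ S₂) (ENNReal.ofReal_pos.2 hε).ne'
    -- the uniform estimate near `Kc`
    obtain ⟨δ, hδ, hunif⟩ :=
      exists_eventually_forall_abs_sub_le_of_mem_thickening φ₂ hφ₂ h hh_lip H hH_lip hSH hKc
        hKcS hε
    -- portmanteau: the mass of the closed complement of the thickening is eventually small
    have hFc : IsClosed (thickening δ Kc)ᶜ := isOpen_thickening.isClosed_compl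
    have hνF : ν₃₂ (thickening δ Kc)ᶜ < ENNReal.ofReal ε :=
      calc ν₃₂ (thickening δ Kc)ᶜ ≤ ν₃₂ (S₂ \ Kc ∪ S₂ᶜ) := by
            refine measure_mono fun y hy ↦ ?_
            by_cases hyS : y ∈ S₂
            · exact Or.inl ⟨hyS, fun hyK ↦ hy (self_subset_thickening hδ Kc hyK)⟩
            · exact Or.inr hyS
        _ ≤ ν₃₂ (S₂ \ Kc) + ν₃₂ S₂ᶜ := measure_union_le _ _
        _ < ENNReal.ofReal ε := by rw [hsupp, add_zero]; exact hKcμ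
    have hPF : ∀ᶠ n in atTop, (κ₃₂ n).map (φ₂ n) (thickening δ Kc)ᶜ < ENNReal.ofReal ε := by
      set P : ℕ → ProbabilityMeasure Z₂ := fun n ↦ ⟨(κ₃₂ n).map (φ₂ n), hP₂ n⟩
      have hPconv : Tendsto P atTop (𝓝 (⟨ν₃₂, inferInstance⟩ : ProbabilityMeasure Z₂)) :=
        ProbabilityMeasure.tendsto_of_tendsto_wassersteinW1 h₃₂
      exact eventually_lt_of_limsup_lt
        ((ProbabilityMeasure.limsup_measure_closed_le_of_tendsto hPconv hFc).trans_lt hνF)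
    filter_upwards [hunif, hPF] with n hn hnF
    have hT : MeasurableSet (φ₂ n ⁻¹' thickening δ Kc) := hφ₂m n isOpen_thickening.measurableSet
    have hest := abs_integral_sub_integral_le_add_mul_measure_compl (κ₃₂ n)
      (hh_lip n).continuous.measurable (hHm.comp (hφ₂m n)) (hh_bdd n) (fun y ↦ hH_bdd _) hT
      hε.le fun y hy ↦ hn y hy
    have hmap : κ₃₂ n (φ₂ n ⁻¹' thickening δ Kc)ᶜ = (κ₃₂ n).map (φ₂ n) (thickening δ Kc)ᶜ := by
      rw [Measure.map_apply (hφ₂m n) hFc.measurableSet, preimage_compl]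
    have hreal : ((κ₃₂ n).map (φ₂ n) (thickening δ Kc)ᶜ).toReal ≤ ε :=
      ENNReal.toReal_le_of_le_ofReal hε.le hnF.le
    calc |∫ y, h n y ∂κ₃₂ n - ∫ y, H (φ₂ n y) ∂κ₃₂ n|
        ≤ ε + 2 * C * (κ₃₂ n (φ₂ n ⁻¹' thickening δ Kc)ᶜ).toReal := hest
      _ ≤ ε + 2 * C * ε := by rw [hmap]; gcongr
      _ = (2 * C + 1) * ε := by ring
  -- Step 6: conclusion
  have hdiff := hlim₁.sub hlim₂
  have habs : ∀ ε, 0 < ε → |∫ z, g z ∂ν₃₁ - ∫ y, hinf y ∂ν₃₂| ≤ (2 * C + 1) * ε := fun ε hε ↦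
    le_of_tendsto hdiff.abs (hkey ε hε)
  have h0 : |∫ z, g z ∂ν₃₁ - ∫ y, hinf y ∂ν₃₂| ≤ 0 := by
    refine le_of_forall_pos_le_add fun ε hε ↦ ?_
    have h1 := habs (ε / (2 * C + 1)) (by positivity)
    rw [mul_div_cancel₀ _ (by positivity : (2 * C + 1 : ℝ) ≠ 0)] at h1
    linarith
  exact sub_eq_zero.1 (abs_nonpos_iff.1 h0)

end Literature.Geometry.Riemannian

end
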